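import Mathlib.Analysis.Calculus.MeanValue
import Mathlib.Analysis.SpecialFunctions.ExpDeriv
import Mathlib.Analysis.SpecialFunctions.Pow.Real
import Literature.Analysis.FluidPDE.CompressibleEulerImplosionUniqueness
import Literature.Analysis.FluidPDE.CompressibleEulerImplosionODEContinuation
import HarnessLib

/-!
# Buckmaster–Cao-Labora–Gómez-Serrano at `γ = 5/3`: `P_∞ = (0,0)` is a sink of (1.8)

Topic `Literature/Analysis/FluidPDE`; namespace
`Literature.Analysis.FluidPDE.BuckmasterCaolaboraGomezserrano2025.Monatomic`. Companion of
`CompressibleEulerImplosion.lean` (named fact `BuckmasterCaolaboraGomezserrano2025_thm11_monatomic`,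
THEOREM 1.1 of T. Buckmaster, G. Cao-Labora, J. Gómez-Serrano, *Smooth imploding solutions for 3D
compressible fluids*, Forum Math. Pi 13 (2025) e6, arXiv:2208.09445, at `γ = 5/3`, `α = 1/3`),
of `CompressibleEulerImplosionUniqueness.lean` (the field `F = (N_W/D_W, N_Z/D_Z)` of (1.8)) and
of `CompressibleEulerImplosionODEContinuation.lean` (global existence under confinement).

Brick E-sink of the discharge plan — the local dynamics at `P_∞ = (0, 0)` behind the conclusion
"`(W, Z) → P_∞` as `ξ → +∞`" of Proposition 3.1 (and behind the limits `U/ζ, S/ζ → 0` of the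
vendored statement): for `r > 0` the linearisation of (1.8) at `P_∞` is `−r·Id`, and with the
Lyapunov function `V = W² + Z²` one has `V′ ≤ −rV` on `{V ≤ ρ(r)²}`, `ρ(r) = min(1/2, r/(14+8r))`
(`lyap_deriv_le`). Consequences: solutions starting in `{V ≤ ρ²/4}` stay in `{V ≤ ρ²/2}`
(`lyap_le_of_solution`, fencing), decay exponentially (`lyap_le_exp_of_solution`), tend to `P_∞`
(`tendsto_zero_of_solution`), and exist for all later times (`exists_solution_tendsto_zero`).
Real definitions (`lyap`, `sinkRad`) + theorems. [cite: BuckmasterCaolaboraGomezserrano2025, Prop. 1.6, Prop. 3.1]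
-/

noncomputable section

open Set Filter Metric Topology

namespace Literature.Analysis.FluidPDE

namespace BuckmasterCaolaboraGomezserrano2025

namespace Monatomic

open ODE

variable {r : ℝ}

/-- The Lyapunov function `V(W,Z) = W² + Z²`. [folklore] -/
def lyap (p : ℝ × ℝ) : ℝ := p.1 ^ 2 + p.2 ^ 2

/-- The radius `ρ(r) = min(1/2, r/(14 + 8r))` inside which `V′ ≤ −rV` along (1.8). [folklore] -/
def sinkRad (r : ℝ) : ℝ := min (1 / 2) (r / (14 + 8 * r))

/-- [folklore] -/
theorem sinkRad_pos (hr : 0 < r) : 0 < sinkRad r := by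
  unfold sinkRad
  exact lt_min (by norm_num) (by positivity)

/-- [folklore] -/
theorem sinkRad_le_half (r : ℝ) : sinkRad r ≤ 1 / 2 := min_le_left _ _

/-- [folklore] -/
theorem sinkRad_mul_le (hr : 0 < r) : sinkRad r * (14 + 8 * r) ≤ r := by
  have h := min_le_right (1 / 2 : ℝ) (r / (14 + 8 * r))
  unfold sinkRad
  rwa [le_div_iff₀ (by positivity)] at h

/-- [folklore] -/
theorem lyap_nonneg (p : ℝ × ℝ) : 0 ≤ lyap p := by unfold lyap; positivity

/-- `|W|, |Z| ≤ ρ` when `V ≤ ρ²`. [folklore] -/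
theorem abs_le_of_lyap_le {p : ℝ × ℝ} {ρ : ℝ} (hρ : 0 ≤ ρ) (h : lyap p ≤ ρ ^ 2) :
    |p.1| ≤ ρ ∧ |p.2| ≤ ρ := by
  unfold lyap at h
  constructor
  · exact abs_le_of_sq_le_sq (by nlinarith [sq_nonneg p.2]) hρ
  · exact abs_le_of_sq_le_sq (by nlinarith [sq_nonneg p.1]) hρ

/-- One component of the key estimate: for `|W|, |Z| ≤ δ ≤ 1/2`,
`W N_W / D_W ≤ −rW² + (7δ/6 + 2δ(r+1)) (W² + Z²)` and `D_W ≥ 1/2`. [folklore] -/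
theorem comp_estimate (hr : 0 < r) {W Z δ : ℝ} (hδ : δ ≤ 1 / 2) (hW : |W| ≤ δ) (hZ : |Z| ≤ δ) :
    1 / 2 ≤ DW W Z ∧
      W * NW r W Z / DW W Z ≤ -r * W ^ 2 + (7 * δ / 6 + 2 * δ * (r + 1)) * (W ^ 2 + Z ^ 2) := by
  have hδ0 : 0 ≤ δ := (abs_nonneg W).trans hW
  have hW2 : 0 ≤ W ^ 2 := sq_nonneg W
  have hZ2 : 0 ≤ Z ^ 2 := sq_nonneg Z
  set V := W ^ 2 + Z ^ 2 with hV
  have hV0 : 0 ≤ V := by positivity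
  -- `|D_W − 1| ≤ δ`
  have hd : |DW W Z - 1| ≤ δ := by
    have e : DW W Z - 1 = (2 * W + Z) / 3 := by unfold DW; ring
    rw [e, abs_div, abs_of_pos (by norm_num : (0:ℝ) < 3), div_le_iff₀ (by norm_num : (0:ℝ) < 3)]
    have := abs_add_le (2 * W) Z
    rw [abs_mul, abs_two] at this
    linarith
  have hD : 1 / 2 ≤ DW W Z := by
    have := neg_abs_le (DW W Z - 1)
    linarith
  have hDpos : 0 < DW W Z := by linarith
  refine ⟨hD, ?_⟩
  -- `A = W N_W = −rW² + e`, `|e| ≤ (7δ/6) V`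
  set e := -(5 * W / 6 + Z / 3) * W ^ 2 + W * Z ^ 2 / 6 with he
  have hA : W * NW r W Z = -r * W ^ 2 + e := by unfold NW; rw [he]; ring
  have he_abs : |e| ≤ 7 * δ / 6 * V := by
    have h1 : |-(5 * W / 6 + Z / 3) * W ^ 2| ≤ (5 * δ / 6 + δ / 3) * W ^ 2 := by
      rw [abs_mul, abs_neg, abs_of_nonneg hW2]
      refine mul_le_mul_of_nonneg_right ?_ hW2
      have := abs_add_le (5 * W / 6) (Z / 3)
      rw [abs_div, abs_div, abs_mul, abs_of_pos (by norm_num : (0:ℝ) < 5),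
        abs_of_pos (by norm_num : (0:ℝ) < 6), abs_of_pos (by norm_num : (0:ℝ) < 3)] at this
      linarith
    have h2 : |W * Z ^ 2 / 6| ≤ δ / 6 * Z ^ 2 := by
      rw [abs_div, abs_mul, abs_of_nonneg hZ2, abs_of_pos (by norm_num : (0:ℝ) < 6)]
      rw [div_le_iff₀ (by norm_num : (0:ℝ) < 6)]
      nlinarith
    have := abs_add_le (-(5 * W / 6 + Z / 3) * W ^ 2) (W * Z ^ 2 / 6)
    rw [← he] at this
    rw [hV]
    nlinarith
  have hA_abs : |W * NW r W Z| ≤ (r + 1) * V := by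
    rw [hA]
    have := abs_add_le (-r * W ^ 2) e
    rw [abs_mul, abs_neg, abs_of_pos hr, abs_of_nonneg hW2] at this
    have : r * W ^ 2 ≤ r * V := by rw [hV]; nlinarith
    nlinarith
  -- `A / D = A − A (D − 1) / D`
  have hsplit : W * NW r W Z / DW W Z = W * NW r W Z - W * NW r W Z * (DW W Z - 1) / DW W Z := by
    field_simp
    ring
  have hcorr : |W * NW r W Z * (DW W Z - 1) / DW W Z| ≤ 2 * δ * (r + 1) * V := by
    rw [abs_div, abs_mul, abs_of_pos hDpos, div_le_iff₀ hDpos]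
    calc |W * NW r W Z| * |DW W Z - 1| ≤ (r + 1) * V * δ :=
          mul_le_mul hA_abs hd (abs_nonneg _) (by positivity)
      _ = 2 * δ * (r + 1) * V * (1 / 2) := by ring
      _ ≤ 2 * δ * (r + 1) * V * DW W Z := by gcongr
  have h3 := neg_abs_le (W * NW r W Z * (DW W Z - 1) / DW W Z)
  have h4 := le_abs_self e
  rw [hsplit]
  linarith [hA, he_abs, h4, hcorr, h3]

/-- **Key estimate**: inside `V ≤ ρ(r)²`, `D_W, D_Z ≥ 1/2` and
`V′ = 2(W N_W/D_W + Z N_Z/D_Z) ≤ −r V` along (1.8). [folklore] -/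
theorem lyap_deriv_le (hr : 0 < r) {p : ℝ × ℝ} (hp : lyap p ≤ sinkRad r ^ 2) :
    1 / 2 ≤ DW p.1 p.2 ∧ 1 / 2 ≤ DZ p.1 p.2 ∧
      2 * (p.1 * (NW r p.1 p.2 / DW p.1 p.2) + p.2 * (NZ r p.1 p.2 / DZ p.1 p.2)) ≤ -r * lyap p := by
  obtain ⟨hW, hZ⟩ := abs_le_of_lyap_le (sinkRad_pos hr).le hp
  have hδ := sinkRad_le_half r
  have hδr := sinkRad_mul_le hr
  have hδ0 := (sinkRad_pos hr).le
  obtain ⟨hD1, h1⟩ := comp_estimate hr hδ hW hZ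
  -- the `Z`-component is the `W`-component of the mirrored system
  have hsymmD : DZ p.1 p.2 = DW p.2 p.1 := by unfold DZ DW; ring
  have hsymmN : NZ r p.1 p.2 = NW r p.2 p.1 := by unfold NZ NW; ring
  obtain ⟨hD2, h2⟩ := comp_estimate hr hδ hZ hW
  rw [← hsymmD] at hD2
  rw [← hsymmD, ← hsymmN] at h2
  refine ⟨hD1, hD2, ?_⟩
  unfold lyap
  have hV0 : 0 ≤ p.1 ^ 2 + p.2 ^ 2 := by positivity
  have e1 : p.1 * (NW r p.1 p.2 / DW p.1 p.2) = p.1 * NW r p.1 p.2 / DW p.1 p.2 := by ring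
  have e2 : p.2 * (NZ r p.1 p.2 / DZ p.1 p.2) = p.2 * NZ r p.1 p.2 / DZ p.1 p.2 := by ring
  rw [e1, e2]
  have hcoef : 2 * (7 * sinkRad r / 6 + 2 * sinkRad r * (r + 1)) ≤ r / 2 := by nlinarith
  nlinarith [mul_le_mul_of_nonneg_right hcoef hV0]

/-- The sublevel sets `{V ≤ m}` are compact. [folklore] -/
theorem isCompact_lyap_le (m : ℝ) : IsCompact {p : ℝ × ℝ | lyap p ≤ m} := by
  refine Metric.isCompact_of_isClosed_isBounded ?_ ?_
  · exact isClosed_le (by unfold lyap; fun_prop) continuous_const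
  · refine (Metric.isBounded_closedBall (x := (0 : ℝ × ℝ)) (r := Real.sqrt (max m 0))).subset ?_
    intro p hp
    have hm : lyap p ≤ max m 0 := le_trans hp (le_max_left _ _)
    have h0 : 0 ≤ max m 0 := le_max_right _ _
    have hsq : Real.sqrt (max m 0) ^ 2 = max m 0 := Real.sq_sqrt h0
    obtain ⟨h1, h2⟩ := abs_le_of_lyap_le (Real.sqrt_nonneg _) (hsq ▸ hm)
    rw [mem_closedBall, dist_zero_right, Prod.norm_def, Real.norm_eq_abs, Real.norm_eq_abs]
    exact max_le h1 h2

/-- Derivative of `V` along a curve. [folklore] -/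
theorem hasDerivAt_lyap {c : ℝ → ℝ × ℝ} {v : ℝ × ℝ} {t : ℝ} (hc : HasDerivAt c v t) :
    HasDerivAt (fun s => lyap (c s)) (2 * ((c t).1 * v.1 + (c t).2 * v.2)) t := by
  have h1 : HasDerivAt (fun s => (c s).1) v.1 t := hc.fst
  have h2 : HasDerivAt (fun s => (c s).2) v.2 t := hc.snd
  have h := (h1.mul h1).add (h2.mul h2)
  have e : (fun s => lyap (c s)) = fun s => (c s).1 * (c s).1 + (c s).2 * (c s).2 := by
    funext s; simp only [lyap, sq]
  rw [e]
  refine h.congr_deriv ?_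
  ring

/-- **Confinement**: a solution of (1.8) starting in `{V ≤ ρ²/4}` stays in `{V ≤ ρ²/2}` (for
`r > 0`). [folklore] -/
theorem lyap_le_of_solution (hr : 0 < r) {c : ℝ → ℝ × ℝ} {t₀ T : ℝ}
    (hc : ∀ t ∈ Ico t₀ T, HasDerivAt c (field r (c t)) t)
    (h0 : lyap (c t₀) ≤ sinkRad r ^ 2 / 4) : ∀ t ∈ Ico t₀ T, lyap (c t) ≤ sinkRad r ^ 2 / 2 := by
  intro t ht
  have hρ := sinkRad_pos hr
  -- fence on `[t₀, t]` with the constant barrier `ρ²/2`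
  have key := image_le_of_deriv_right_lt_deriv_boundary (f := fun s => lyap (c s))
    (f' := fun s => 2 * ((c s).1 * (field r (c s)).1 + (c s).2 * (field r (c s)).2))
    (a := t₀) (b := t) (B := fun _ => sinkRad r ^ 2 / 2) (B' := fun _ => 0) ?_ ?_ ?_ ?_ ?_
  · exact key (right_mem_Icc.mpr ht.1)
  · intro s hs
    exact (hasDerivAt_lyap (hc s ⟨hs.1, lt_of_le_of_lt hs.2 ht.2⟩)).continuousAt.continuousWithinAt
  · intro s hs
    exact (hasDerivAt_lyap (hc s ⟨hs.1, hs.2.trans ht.2⟩)).hasDerivWithinAt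
  · show lyap (c t₀) ≤ sinkRad r ^ 2 / 2
    nlinarith
  · intro s; exact hasDerivAt_const s _
  · intro s _ hs
    have hs' : lyap (c s) ≤ sinkRad r ^ 2 := by rw [hs]; nlinarith
    have h := (lyap_deriv_le hr hs').2.2
    have hpos : 0 < lyap (c s) := by rw [hs]; positivity
    show 2 * ((c s).1 * (field r (c s)).1 + (c s).2 * (field r (c s)).2) < 0
    unfold field
    dsimp only
    nlinarith

/-- **Exponential decay**: a solution of (1.8) on `[t₀, ∞)` (`r > 0`) starting in `{V ≤ ρ²/4}`
satisfies `V(c(t)) ≤ (ρ²/2) e^{−(r/2)(t−t₀)}`. [folklore] -/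
theorem lyap_le_exp_of_solution (hr : 0 < r) {c : ℝ → ℝ × ℝ} {t₀ : ℝ}
    (hc : ∀ t, t₀ ≤ t → HasDerivAt c (field r (c t)) t) (h0 : lyap (c t₀) ≤ sinkRad r ^ 2 / 4) :
    ∀ t, t₀ ≤ t → lyap (c t) ≤ sinkRad r ^ 2 / 2 * Real.exp (-(r / 2) * (t - t₀)) := by
  intro t ht
  have hρ := sinkRad_pos hr
  have hB : ∀ s, HasDerivAt (fun s => sinkRad r ^ 2 / 2 * Real.exp (-(r / 2) * (s - t₀)))
      (sinkRad r ^ 2 / 2 * (Real.exp (-(r / 2) * (s - t₀)) * (-(r / 2)))) s := by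
    intro s
    have h1 : HasDerivAt (fun s => -(r / 2) * (s - t₀)) (-(r / 2)) s := by
      simpa using ((hasDerivAt_id s).sub_const t₀).const_mul (-(r / 2))
    exact (h1.exp).const_mul _
  have key := image_le_of_deriv_right_lt_deriv_boundary (f := fun s => lyap (c s))
    (f' := fun s => 2 * ((c s).1 * (field r (c s)).1 + (c s).2 * (field r (c s)).2))
    (a := t₀) (b := t) ?_ ?_ ?_ hB ?_
  · exact key (right_mem_Icc.mpr ht)
  · intro s hs
    exact (hasDerivAt_lyap (hc s hs.1)).continuousAt.continuousWithinAt
  · intro s hs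
    exact (hasDerivAt_lyap (hc s hs.1)).hasDerivWithinAt
  · show lyap (c t₀) ≤ sinkRad r ^ 2 / 2 * Real.exp (-(r / 2) * (t₀ - t₀))
    rw [sub_self, mul_zero, Real.exp_zero, mul_one]
    nlinarith
  · intro s hs hsB
    have hE := Real.exp_pos (-(r / 2) * (s - t₀))
    have hE1 : Real.exp (-(r / 2) * (s - t₀)) ≤ 1 := by
      rw [Real.exp_le_one_iff]; nlinarith [hs.1]
    have hs' : lyap (c s) ≤ sinkRad r ^ 2 := by rw [hsB]; nlinarith
    have h := (lyap_deriv_le hr hs').2.2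
    show 2 * ((c s).1 * (field r (c s)).1 + (c s).2 * (field r (c s)).2)
      < sinkRad r ^ 2 / 2 * (Real.exp (-(r / 2) * (s - t₀)) * (-(r / 2)))
    unfold field
    dsimp only
    rw [hsB] at h
    have hpos : 0 < r * (sinkRad r ^ 2 / 2 * Real.exp (-(r / 2) * (s - t₀))) := by positivity
    nlinarith

/-- **Attraction**: a solution of (1.8) on `[t₀, ∞)` (`r > 0`) starting in `{V ≤ ρ(r)²/4}` tends
to `P_∞ = (0, 0)`. [cite: BuckmasterCaolaboraGomezserrano2025, Prop. 3.1] -/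
theorem tendsto_zero_of_solution (hr : 0 < r) {c : ℝ → ℝ × ℝ} {t₀ : ℝ}
    (hc : ∀ t, t₀ ≤ t → HasDerivAt c (field r (c t)) t) (h0 : lyap (c t₀) ≤ sinkRad r ^ 2 / 4) :
    Tendsto c atTop (𝓝 0) := by
  have hexp := lyap_le_exp_of_solution hr hc h0
  have hV : Tendsto (fun t => lyap (c t)) atTop (𝓝 0) := by
    have hup : Tendsto (fun t => sinkRad r ^ 2 / 2 * Real.exp (-(r / 2) * (t - t₀)))
        atTop (𝓝 0) := by
      have h1 : Tendsto (fun t : ℝ => t - t₀) atTop atTop := tendsto_atTop_add_const_right _ _ tendsto_id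
      have h2 : Tendsto (fun t => -(r / 2) * (t - t₀)) atTop atBot :=
        h1.const_mul_atTop_of_neg (by linarith)
      have h3 := Real.tendsto_exp_atBot.comp h2
      simpa using h3.const_mul (sinkRad r ^ 2 / 2)
    refine tendsto_of_tendsto_of_tendsto_of_le_of_le' tendsto_const_nhds hup ?_ ?_
    · exact Eventually.of_forall fun t => lyap_nonneg _
    · filter_upwards [eventually_ge_atTop t₀] with t ht using hexp t ht
  rw [tendsto_zero_iff_norm_tendsto_zero]
  have hsqrt : Tendsto (fun t => Real.sqrt (lyap (c t))) atTop (𝓝 0) := by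
    have := (Real.continuous_sqrt.tendsto 0).comp hV
    rw [Real.sqrt_zero] at this
    exact this
  refine tendsto_of_tendsto_of_tendsto_of_le_of_le' tendsto_const_nhds hsqrt
    (Eventually.of_forall fun t => norm_nonneg _) (Eventually.of_forall fun t => ?_)
  have hnn : 0 ≤ Real.sqrt (lyap (c t)) := Real.sqrt_nonneg _
  have hsq : Real.sqrt (lyap (c t)) ^ 2 = lyap (c t) := Real.sq_sqrt (lyap_nonneg _)
  obtain ⟨h1, h2⟩ := abs_le_of_lyap_le hnn (le_of_eq hsq.symm)
  show ‖c t‖ ≤ Real.sqrt (lyap (c t))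
  rw [Prod.norm_def, Real.norm_eq_abs, Real.norm_eq_abs]
  exact max_le h1 h2

/-- **`P_∞` is a sink** (the local dynamics at `P_∞ = (0,0)` behind "`(W, Z) → P_∞` as
`ξ → +∞`" in Proposition 3.1, for `r > 0`): every `p₀` with `V(p₀) ≤ ρ(r)²/4` is the initial value
(at any time `t₀`) of a solution of (1.8) defined for all `t ≥ t₀`, which stays in `{V ≤ ρ²/2}`
(in particular off the sonic lines), decays exponentially and tends to `P_∞`.
[cite: BuckmasterCaolaboraGomezserrano2025, Prop. 1.6, Prop. 3.1] -/
theorem exists_solution_tendsto_zero [CompleteSpace (ℝ × ℝ)] (hr : 0 < r) {p₀ : ℝ × ℝ}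
    (hp₀ : lyap p₀ ≤ sinkRad r ^ 2 / 4) (t₀ : ℝ) :
    ∃ c : ℝ → ℝ × ℝ, c t₀ = p₀ ∧ (∀ t, t₀ ≤ t → HasDerivAt c (field r (c t)) t) ∧
      (∀ t, t₀ ≤ t → lyap (c t) ≤ sinkRad r ^ 2 / 2) ∧
      (∀ t, t₀ ≤ t → lyap (c t) ≤ sinkRad r ^ 2 / 2 * Real.exp (-(r / 2) * (t - t₀))) ∧
      Tendsto c atTop (𝓝 0) := by
  have hρ := sinkRad_pos hr
  set K : Set (ℝ × ℝ) := {p | lyap p ≤ sinkRad r ^ 2 / 2} with hK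
  set U : Set (ℝ × ℝ) := {p | DW p.1 p.2 ≠ 0 ∧ DZ p.1 p.2 ≠ 0} with hU
  have hKU : K ⊆ U := fun p hp => by
    have hp' : lyap p ≤ sinkRad r ^ 2 := le_trans hp (by nlinarith)
    have h := lyap_deriv_le hr hp'
    exact ⟨by linarith [h.1], by linarith [h.2.1]⟩
  have hF : ∀ x ∈ U, ContDiffAt ℝ 1 (field r) x := fun x hx => contDiffAt_field hx.1 hx.2
  have hp₀K : p₀ ∈ K := by show lyap p₀ ≤ _; nlinarith
  obtain ⟨c, δ, _, hc0, hc⟩ := exists_forall_hasDerivAt_of_confined hF (isCompact_lyap_le _)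
    hKU hp₀K t₀ (fun c T hcT hc' t ht => lyap_le_of_solution hr hc' (by rw [hcT]; exact hp₀) t ht)
  have hc' : ∀ t, t₀ ≤ t → HasDerivAt c (field r (c t)) t := fun t ht => hc t (by linarith)
  have h0 : lyap (c t₀) ≤ sinkRad r ^ 2 / 4 := by rw [hc0]; exact hp₀
  refine ⟨c, hc0, hc', fun t ht => ?_, lyap_le_exp_of_solution hr hc' h0,
    tendsto_zero_of_solution hr hc' h0⟩
  exact lyap_le_of_solution hr (T := t + 1) (fun s hs => hc' s hs.1) h0 t ⟨ht, by linarith⟩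

end Monatomic

end BuckmasterCaolaboraGomezserrano2025

end Literature.Analysis.FluidPDE
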